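import Summits.Ventures.DiscreteObjects.Hadamard.Frobenius37Row

/-!
# Hadamard 668 census, family F12 — the Frobenius class `Z₃₇ ⋊ Z₁₂` (three cyclotomic classes) in the kernel

Framing: lottery ticket; floor = certified bounds/negative ranges.

Cell pub-namedobj (venture DiscreteObjects), target (H), hadamard gen 4, family F12 (FAMILY-F12.md).  For `p = 37`
(`667 = 18·37 + 1`: eighteen point-orbits, one fixed point) and `U = ⟨8⟩ ≤ (ℤ/37)ˣ` of order 12 (index `e = 3`, cosets
`⟨8⟩, 2⟨8⟩, 4⟨8⟩`), one point-orbit row of the incidence matrix of a symmetric 2-(667,333,166) design with the automorphism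
group `Z₃₇ ⋊ U` (orbit lengths {1, 37}) becomes 18 `0/1` functions `x_j : ZMod 37 → {0,1}` invariant under `i ↦ 8 i`, with
`Σ_j |x_j| = 333 - σ` and `Σ_j PAF_(x_j)(s) = 166 - σ` for every `s ≠ 0` (`σ ∈ {0,1}`; FAMILY-F12 §2).  The class was decided
NONE by three independent exhaustive enumerations; this file is a kernel certificate with a ONE-LINE reason found
afterwards: an `8`-invariant `0/1` function is a four-valued block (`eq_blk37c`; tables by `decide`), and each of the sixteen
blocks satisfies the CONVEXITY inequality `PAF(1) + PAF(2) + PAF(4) - 3·|x| + 26 ≥ 0` (`blk37c_convex`, by `decide`; it is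
`12·ΣPAF = |x|(|x|-1)` together with `(|x| - 13)(|x| - 24) ≥ 0`, the weights being `0,1,12,13,24,25,36,37`), whereas summing
over the 18 blocks gives `3(166-σ) - 3(333-σ) + 18·26 = -33 < 0` (`no_frobenius37_index3_row`).
Ours, not literature; no `sorry`, no `native_decide`.
-/

open Finset BigOperators

namespace Summit.Ventures.DiscreteObjects.Hadamard

open Literature.Combinatorics.Designs.LegendrePairs (PAF)

/-! ## §1 The orbit of the multiplier `8` on `ZMod 37` and the three classes (tables, kernel-checked) -/

/-- `orb37c k = 8^k` in `ZMod 37` (`8` has order 12) -/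
def orb37c : ℕ → ZMod 37
  | 0 => 1
  | k + 1 => 8 * orb37c k

/-- class table: `0` on `⟨8⟩`, `1` on `2⟨8⟩`, `2` on `4⟨8⟩` (and `0` at `0`) -/
def cls37c : List ℕ :=
  [0, 0, 1, 2, 2, 2, 0, 2, 0, 1, 0, 0, 1, 2, 0, 1, 1, 1, 2, 2, 1, 1, 1, 0, 2, 1, 0, 0, 1, 0, 2, 0, 2, 2, 2, 1, 0]

/-- discrete-logarithm table: `i = r · orb37c (dlog37c[i])` with `r = 1, 2, 4` according to the class of `i` -/
def dlog37c : List ℕ :=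
  [0, 0, 0, 8, 0, 7, 9, 10, 1, 5, 8, 10, 9, 3, 11, 4, 1, 2, 5, 11, 8, 7, 10, 5, 9, 3, 4, 2, 11, 7, 4, 3, 1, 6, 2, 6, 6]

/-- the class of a residue (table lookup) -/
def clsOf37c (i : ZMod 37) : ℕ := cls37c.getD i.val 0

set_option maxRecDepth 100000 in
/-- kernel check of the tables: every non-zero residue is `orb`, `2·orb` or `4·orb` of its logarithm, according to its class -/
theorem orbit_cover37c : ∀ i : ZMod 37,
    i = 0 ∨ (clsOf37c i = 0 ∧ orb37c (dlog37c.getD i.val 0) = i) ∨ (clsOf37c i = 1 ∧ 2 * orb37c (dlog37c.getD i.val 0) = i) ∨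
      (clsOf37c i = 2 ∧ 4 * orb37c (dlog37c.getD i.val 0) = i) := by
  decide

/-- invariance under `i ↦ 8 i` propagates along the orbit walk from `1`, `2` and `4` -/
lemma apply_orb37c {α : Type*} (x : ZMod 37 → α) (hinv : ∀ i, x (8 * i) = x i) (k : ℕ) :
    x (orb37c k) = x 1 ∧ x (2 * orb37c k) = x 2 ∧ x (4 * orb37c k) = x 4 := by
  induction k with
  | zero => simp [orb37c]
  | succ k ih =>
    refine ⟨?_, ?_, ?_⟩
    · show x (8 * orb37c k) = x 1
      rw [hinv]; exact ih.1
    · show x (2 * (8 * orb37c k)) = x 2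
      rw [mul_left_comm, hinv]; exact ih.2.1
    · show x (4 * (8 * orb37c k)) = x 4
      rw [mul_left_comm, hinv]; exact ih.2.2

/-- the four-valued block: `e0` at `0`, `e1, e2, e3` on the three classes -/
def blk37c {α : Type*} (e0 e1 e2 e3 : α) (i : ZMod 37) : α :=
  if i = 0 then e0 else if clsOf37c i = 0 then e1 else if clsOf37c i = 1 then e2 else e3

/-- an `8`-invariant function on `ZMod 37` is the block of its values at `0, 1, 2, 4` -/
theorem eq_blk37c {α : Type*} (x : ZMod 37 → α) (hinv : ∀ i, x (8 * i) = x i) :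
    x = blk37c (x 0) (x 1) (x 2) (x 4) := by
  funext i
  by_cases hi : i = 0
  · subst hi; simp [blk37c]
  · rcases orbit_cover37c i with h0 | ⟨hq, he⟩ | ⟨hq, he⟩ | ⟨hq, he⟩
    · exact absurd h0 hi
    · have h := (apply_orb37c x hinv (dlog37c.getD i.val 0)).1
      rw [he] at h
      unfold blk37c; rw [if_neg hi, if_pos hq]; exact h
    · have h := (apply_orb37c x hinv (dlog37c.getD i.val 0)).2.1
      rw [he] at h
      have h1 : ¬ (clsOf37c i = 0) := by rw [hq]; decide
      unfold blk37c; rw [if_neg hi, if_neg h1, if_pos hq]; exact h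
    · have h := (apply_orb37c x hinv (dlog37c.getD i.val 0)).2.2
      rw [he] at h
      have h1 : ¬ (clsOf37c i = 0) := by rw [hq]; decide
      have h2 : ¬ (clsOf37c i = 1) := by rw [hq]; decide
      unfold blk37c; rw [if_neg hi, if_neg h1, if_neg h2]; exact h

/-! ## §2 The convexity inequality of the sixteen `0/1` blocks (kernel-checked) -/

set_option maxRecDepth 100000 in
set_option maxHeartbeats 4000000 in
/-- for every `0/1` block: `PAF(1) + PAF(2) + PAF(4) - 3·PAF(0) + 26 ≥ 0` (equality for the weights 13 and 24) -/
theorem blk37c_convex : ∀ e0 ∈ [(0 : ℤ), 1], ∀ e1 ∈ [(0 : ℤ), 1], ∀ e2 ∈ [(0 : ℤ), 1], ∀ e3 ∈ [(0 : ℤ), 1],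
    0 ≤ PAF (blk37c e0 e1 e2 e3) 1 + PAF (blk37c e0 e1 e2 e3) 2 + PAF (blk37c e0 e1 e2 e3) 4
      - 3 * PAF (blk37c e0 e1 e2 e3) 0 + 26 := by
  decide

/-! ## §3 The row system has no solution -/

/-- **Family F12, class `Z₃₇ ⋊ Z₁₂` (kernel certificate of the row system).**  There are no 18 `0/1` functions on
`ZMod 37`, invariant under `⟨8⟩`, with `Σ_j |x_j| = 333 - σ` and `Σ_j PAF_(x_j)(s) = 166 - σ` at `s = 1, 2, 4` — for ANY
integer `σ` (the census needs `σ ∈ {0,1}`).  `mem_01`, `paf_zero_01_37` are reused from `Frobenius83Row`/`Frobenius37Row`. -/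
theorem no_frobenius37_index3_row (x : Fin 18 → ZMod 37 → ℤ) (h01 : ∀ j i, x j i = 0 ∨ x j i = 1)
    (hinv : ∀ j i, x j (8 * i) = x j i) (σ : ℤ)
    (hw : ∑ j, ∑ i, x j i = 333 - σ) (hP1 : ∑ j, PAF (x j) 1 = 166 - σ) (hP2 : ∑ j, PAF (x j) 2 = 166 - σ)
    (hP4 : ∑ j, PAF (x j) 4 = 166 - σ) : False := by
  have hb : ∀ j, 0 ≤ PAF (x j) 1 + PAF (x j) 2 + PAF (x j) 4 - 3 * PAF (x j) 0 + 26 := by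
    intro j
    have := blk37c_convex (x j 0) (mem_01 (h01 j 0)) (x j 1) (mem_01 (h01 j 1)) (x j 2) (mem_01 (h01 j 2))
      (x j 4) (mem_01 (h01 j 4))
    rw [← eq_blk37c (x j) (hinv j)] at this
    exact this
  have hw' : ∑ j, PAF (x j) 0 = 333 - σ := by
    rw [Finset.sum_congr rfl (fun j _ => paf_zero_01_37 (x j) (h01 j))]; exact hw
  have hsum : 0 ≤ ∑ j, (PAF (x j) 1 + PAF (x j) 2 + PAF (x j) 4 - 3 * PAF (x j) 0 + 26) :=
    Finset.sum_nonneg fun j _ => hb j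
  simp only [Finset.sum_add_distrib, Finset.sum_sub_distrib, ← Finset.mul_sum, Finset.sum_const, Finset.card_univ,
    Fintype.card_fin] at hsum
  rw [hP1, hP2, hP4, hw'] at hsum
  norm_num at hsum
  linarith

end Summit.Ventures.DiscreteObjects.Hadamard
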